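import Summits.KontsevichZagierPeriods.KontsevichZagierPeriods.Theorems.CompleteModGammaSector.Negative.Admissible
import Summits.KontsevichZagierPeriods.KontsevichZagierPeriods.Theorems.CompleteModGammaSector.Negative.DimZeroInvariant

/-!
# `CompleteModGammaSector` — the hypothesis `relations ≤ H` is load-bearing; Newton–Leibniz in the `H`-form

Closes the two references left open by `Negative/Admissible.lean` (cdisprove gen 1, this seat),
using the sibling seat's invariant `ev₀` (`Negative/DimZeroInvariant.lean`):

* `completeModGammaSector_false_without_relationsLe` — `H = closure (Γ-pairs)` satisfies the pair
  hypothesis `PairHyp H` but misses the rational pair `1 = ∫₀¹ dt` (separated by `ev₀`);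
* `completeModGammaSector_false_without_newtonLeibniz_forall` — the `H`-quantified form of
  "Newton–Leibniz is load-bearing": `H = ker ev₀ ⊇ rules (1), (2)` with `PairHyp H` misses it.
-/

noncomputable section

open MeasureTheory Set
open scoped BigOperators

namespace Summit.KontsevichZagierPeriods.CompleteModGammaSectorNegative

open Literature.NumberTheory.Transcendental
open Literature.NumberTheory.Transcendental.KZ
open Literature.Barriers.KontsevichZagierPeriods.KZ (constRep constRep_value constRep_isRational)

/-- **`relations ≤ H` is load-bearing**: `H = closure (Γ-pairs)` satisfies the pair hypothesis but
misses the rational pair `1 = ∫₀¹ dt` (`[pt,1]`, `[[0,1],1]`, separated by `ev₀`). [folklore] -/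
theorem completeModGammaSector_false_without_relationsLe : ¬ CompleteModGammaSectorWithoutRelationsLe := by
  intro h
  have hmem := h (AddSubgroup.closure gammaHodgePairs) ((pairHyp_iff_closure_le _).mpr le_rfl)
    (constRep 1) unitIntervalRep (constRep_isRational 1) unitIntervalRep_isRational
    (by rw [constRep_value, unitIntervalRep_value, Rat.cast_one])
  have h0 : ev₀ (of (constRep 1) - of unitIntervalRep) = 0 := closure_gammaHodgePairs_le_ker_ev₀ hmem
  rw [ev₀_witness] at h0
  exact one_ne_zero h0

/-- **Newton–Leibniz is load-bearing, `H`-form**: the admissible-style subgroup `H = ker ev₀`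
contains rules (1), (2) and satisfies `PairHyp`, but misses `[pt,1] − [[0,1],1]`. [folklore] -/
theorem completeModGammaSector_false_without_newtonLeibniz_forall :
    ¬ ∀ H : AddSubgroup FormalRep, rulesOneTwo ≤ H → PairHyp H →
      ∀ ⦃n m : ℕ⦄ (r : IntegralRep n) (r' : IntegralRep m),
        r.IsRational → r'.IsRational → r.value = r'.value → of r - of r' ∈ H := by
  intro h
  have h0 : ev₀ (of (constRep 1) - of unitIntervalRep) = 0 :=
    h ev₀.ker rulesOneTwo_le_ker_ev₀ ((pairHyp_iff_closure_le _).mpr closure_gammaHodgePairs_le_ker_ev₀)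
      (constRep 1) unitIntervalRep (constRep_isRational 1) unitIntervalRep_isRational
      (by rw [constRep_value, unitIntervalRep_value, Rat.cast_one])
  rw [ev₀_witness] at h0
  exact one_ne_zero h0

end Summit.KontsevichZagierPeriods.CompleteModGammaSectorNegative
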